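import Literature.AlgebraicGeometry.HodgeTheory.ComplexGysinHodgeType
import Literature.AlgebraicGeometry.HodgeTheory.ComplexGysinRational
import Literature.AlgebraicGeometry.HodgeTheory.RationalClassesRingChange
import Literature.AlgebraicGeometry.Motives.ComplexPointsOrientation
import Literature.AlgebraicGeometry.Surfaces.K3HodgeTypes
import Summits.HodgeConjecture.HodgeConjecture.Theorems.NikulinTwinTransportTwinSimilitudeAlgebraicMarkings

/-!
# Route NikulinTwinTransport · `SquareGlue` (stmt-HodgeConjecture-13682) — Künneth bookkeeping IV:
# Hodge types and rationality of correspondence-type classes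

Helper file for the glue item `SquareGlue`. The Hodge-theoretic inputs of the bookkeeping, all
derived from NAMED FACTS of the tree (no new ones): `hodgePQ_independent_of_hodgeModel` (`hI`) and
de Rham's theorem `exists_deRhamIsoFamily` for finite-dimensional model spaces (`hdR`) — through the
tree's theorems `IsOfHodgeType.map_of_independent`, `cupPreservesHodgeType_of_exists_deRhamIsoFamily`,
`isOfHodgeType_complexGysin_of_cupPreservesHodgeType` (Voisin I §7.3.2, Lemma 7.30), given Hodge
MODELS of the varieties at hand (no `nonempty_hodgeModel`: in the cycle part of the Hodge conjecture
a model of the product is supplied by the Hodge-type hypothesis itself) — and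
`Huybrechts_K3_hodgeTypes_H2` (the Hodge types on `H²` of a projective K3 surface):

* `isOfHodgeType_top`, `isOfHodgeType_smul'`, `isOfHodgeType_add'` — bookkeeping on the `∃`-over-models predicate;
* `isOfHodgeType_corrFst` — the class `fst_*(snd^* w ∪ c)` has the Hodge type of `w` shifted by
  `(type of c) - (dim Z, dim Z)` ("correspondences of Hodge classes are morphisms of Hodge
  structures", Voisin I Lemma 11.41, on the real carriers); `isOfHodgeType_complexGysin_of_models`;
  `isOfHodgeType_corrSnd` — the symmetric statement for `snd_*(fst^* b ∪ c)`;
* `exists_smul_complexGysin_isRationalClass` — a Gysin morphism of the orientation family `μ` maps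
  rational classes to rational classes up to ONE non-zero scalar (`complexGysin_ringChange_eq_smul_gysinMap`);
* `typePreserving_of_lines` — an endomorphism of `H²` of a projective K3 surface fixing the lines
  `H^{2,0}`, `H^{0,2}` and the space `H^{1,1}` preserves every Hodge type `(i, j)`.

Prover seat prover-pitem-stmt-HodgeConjecture-13682-0.
-/

noncomputable section

namespace Summit.HodgeConjecture.HodgeConjecture.Theorems.NikulinTwinTransport

open scoped Manifold
open CategoryTheory MonoidalCategory CartesianMonoidalCategory
open Literature.AlgebraicGeometry.Motives Literature.AlgebraicGeometry.HodgeTheory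
open Literature.AlgebraicGeometry.Surfaces
open Literature.AlgebraicTopology.SingularHomology

/-! ### Bookkeeping on Hodge types -/

section Types

variable {n : ℕ} {X : SchemeOver ℂ}

/-- **Every top-degree class is of type `(n, n)`** in any Hodge model (`hodgePQ_two_mul_finrank_eq_top`:
"the forms of degree `2n` are necessarily of bidegree `(n, n)`"). [cite: VoisinHodgeI2002, Lemma 7.30 (proof) and §2.3.1] -/
theorem isOfHodgeType_top (A : HodgeModel n X) (c : complexBetti X (2 * n)) : IsOfHodgeType n X (2 * n) n n c := by
  refine ⟨A, ?_⟩
  change A.pullback (2 * n) c ∈ (Literature.NumberTheory.Transcendental.hodgePQ A.model A.carrier (2 * n) n n).map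
    (A.deRham A.carrier (2 * n)).toLinearMap
  rw [hodgePQ_two_mul_finrank_eq_top (M := A.carrier) A.isAnalytification.finrank_eq, Submodule.map_top,
    LinearMap.range_eq_top.2 (A.deRham A.carrier (2 * n)).surjective]
  exact Submodule.mem_top

/-- Classes of a given Hodge type are stable under scalars (same witness model). [cite: VoisinHodgeI2002, §7.1.1] -/
theorem isOfHodgeType_smul' {k p q : ℕ} {c : complexBetti X k} (hc : IsOfHodgeType n X k p q c) (t : ℂ) :
    IsOfHodgeType n X k p q (t • c) := by
  obtain ⟨A, hA⟩ := hc
  exact ⟨A, by rw [map_smul]; exact Submodule.smul_mem _ _ hA⟩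

/-- Classes of a given Hodge type are stable under sums, granted that the type may be read in any
model (`hodgePQ_independent_of_hodgeModel`). [cite: VoisinHodgeI2002, §7.1.1] -/
theorem isOfHodgeType_add' (hI : hodgePQ_independent_of_hodgeModel) (hX : IsSmoothProjective n X)
    {k p q : ℕ} {c c' : complexBetti X k} (hc : IsOfHodgeType n X k p q c) (hc' : IsOfHodgeType n X k p q c') :
    IsOfHodgeType n X k p q (c + c') := by
  obtain ⟨A, hA⟩ := hc
  have hA' := (hI.isOfHodgeType_iff hX A).1 hc'
  exact ⟨A, by rw [map_add]; exact Submodule.add_mem _ hA hA'⟩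

/-- Classes of a given Hodge type are stable under differences (`hodgePQ_independent_of_hodgeModel`).
[cite: VoisinHodgeI2002, §7.1.1] -/
theorem isOfHodgeType_sub' (hI : hodgePQ_independent_of_hodgeModel) (hX : IsSmoothProjective n X)
    {k p q : ℕ} {c c' : complexBetti X k} (hc : IsOfHodgeType n X k p q c) (hc' : IsOfHodgeType n X k p q c') :
    IsOfHodgeType n X k p q (c - c') := by
  rw [sub_eq_add_neg, ← neg_one_smul ℂ c']
  exact isOfHodgeType_add' hI hX hc (isOfHodgeType_smul' hc' _)

end Types

/-! ### The Hodge type of `fst_*(snd^* w ∪ c)` -/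

section Corr

variable {m n : ℕ} {Y Z : SchemeOver ℂ}

/-- **The correspondence-type class `fst_*(snd^* w ∪ c)` shifts Hodge types by the type of `c` minus
`(dim Z, dim Z)`.** For `w ∈ Hʲ(Z(ℂ))` of type `(i, l)` and `c ∈ Hᵏ((Y ⊗ Z)(ℂ))` of type `(p, q)`,
the class `fst_*(snd^* w ∪ c) ∈ Hᵇ(Y(ℂ))` is of type `(i', l')` with `i' + dim Z = i + p`,
`l' + dim Z = l + q`: pull-backs preserve types (`IsOfHodgeType.map_of_independent`), cup products
add them (`cupPreservesHodgeType_of_exists_deRhamIsoFamily`) and Gysin morphisms shift them by the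
relative dimension (`isOfHodgeType_complexGysin_of_cupPreservesHodgeType`) — Voisin I §7.3.2,
Lemma 7.30 and Lemma 11.41 ("`[Z]_*` is a morphism of Hodge structures") — given Hodge models of
`Y ⊗ Z` and `Y`, from the named facts `hI` (types may be read in any model) and `hdR` (de Rham,
for the multiplicativity of types).
[cite: VoisinHodgeI2002, §7.3.2, Lemma 7.30 and Lemma 11.41] -/
theorem isOfHodgeType_corrFst (hI : hodgePQ_independent_of_hodgeModel)
    (hdR : ∀ (E : Type) [NormedAddCommGroup E] [NormedSpace ℂ E] [FiniteDimensional ℂ E],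
      Literature.NumberTheory.Transcendental.exists_deRhamIsoFamily 𝓘(ℝ, E))
    (μ : OrientationFamily) (hY : IsSmoothProjective m Y) (hZ : IsSmoothProjective n Z)
    (B : HodgeModel (m + n) (Y ⊗ Z)) (A : HodgeModel m Y)
    {j k a b : ℕ} (hja : j + k = a) (hab : a + 2 * m = b + 2 * (m + n))
    {p q : ℕ} {c : complexBetti (Y ⊗ Z) k} (hc : IsOfHodgeType (m + n) (Y ⊗ Z) k p q c)
    {i l i' l' : ℕ} (hi : i' + n = i + p) (hl : l' + n = l + q)
    {w : complexBetti Z j} (hw : IsOfHodgeType n Z j i l w) :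
    IsOfHodgeType m Y b i' l'
      (complexGysin μ (IsSmoothProjective.tensor_holds hY hZ) hY (fst Y Z) hab
        (cupProduct hja (complexBetti.map (snd Y Z) j w) c)) := by
  have hP := IsSmoothProjective.tensor_holds hY hZ
  have hcP : CupPreservesHodgeType (m + n) (Y ⊗ Z) :=
    cupPreservesHodgeType_of_exists_deRhamIsoFamily hI hP B (hdR B.model)
  have hcY : CupPreservesHodgeType m Y := cupPreservesHodgeType_of_exists_deRhamIsoFamily hI hY A (hdR A.model)
  have hsnd : IsOfHodgeType (m + n) (Y ⊗ Z) j i l (complexBetti.map (snd Y Z) j w) :=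
    hw.map_of_independent hI hP hZ B (snd Y Z)
  have hcup : IsOfHodgeType (m + n) (Y ⊗ Z) a (i + p) (l + q)
      (cupProduct hja (complexBetti.map (snd Y Z) j w) c) := hcP hja hsnd hc
  exact isOfHodgeType_complexGysin_of_cupPreservesHodgeType hI μ hP hY B A hcP hcY (fst Y Z) hab
    (by omega) (by omega) hcup

/-- **The symmetric statement: `snd_*(fst^* b ∪ c)` shifts Hodge types by the type of `c` minus
`(dim Y, dim Y)`** (pull-back along `fst`, cup product, Gysin morphism of `snd`), given Hodge models of
`Y ⊗ Z` and `Z`. [cite: VoisinHodgeI2002, §7.3.2, Lemma 7.30 and Lemma 11.41] -/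
theorem isOfHodgeType_corrSnd (hI : hodgePQ_independent_of_hodgeModel)
    (hdR : ∀ (E : Type) [NormedAddCommGroup E] [NormedSpace ℂ E] [FiniteDimensional ℂ E],
      Literature.NumberTheory.Transcendental.exists_deRhamIsoFamily 𝓘(ℝ, E))
    (μ : OrientationFamily) (hY : IsSmoothProjective m Y) (hZ : IsSmoothProjective n Z)
    (B : HodgeModel (m + n) (Y ⊗ Z)) (A : HodgeModel n Z)
    {i k a b : ℕ} (hia : i + k = a) (hab : a + 2 * n = b + 2 * (m + n))
    {p q : ℕ} {c : complexBetti (Y ⊗ Z) k} (hc : IsOfHodgeType (m + n) (Y ⊗ Z) k p q c)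
    {r l r' l' : ℕ} (hr : r' + m = r + p) (hl : l' + m = l + q)
    {b' : complexBetti Y i} (hb : IsOfHodgeType m Y i r l b') :
    IsOfHodgeType n Z b r' l'
      (complexGysin μ (IsSmoothProjective.tensor_holds hY hZ) hZ (snd Y Z) hab
        (cupProduct hia (complexBetti.map (fst Y Z) i b') c)) := by
  have hP := IsSmoothProjective.tensor_holds hY hZ
  have hcP : CupPreservesHodgeType (m + n) (Y ⊗ Z) :=
    cupPreservesHodgeType_of_exists_deRhamIsoFamily hI hP B (hdR B.model)
  have hcZ : CupPreservesHodgeType n Z := cupPreservesHodgeType_of_exists_deRhamIsoFamily hI hZ A (hdR A.model)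
  have hfst : IsOfHodgeType (m + n) (Y ⊗ Z) i r l (complexBetti.map (fst Y Z) i b') :=
    hb.map_of_independent hI hP hY B (fst Y Z)
  have hcup : IsOfHodgeType (m + n) (Y ⊗ Z) a (r + p) (l + q)
      (cupProduct hia (complexBetti.map (fst Y Z) i b') c) := hcP hia hfst hc
  exact isOfHodgeType_complexGysin_of_cupPreservesHodgeType hI μ hP hZ B A hcP hcZ (snd Y Z) hab
    (by omega) (by omega) hcup

/-- **A Gysin morphism shifts Hodge types by the relative dimension**, given Hodge models of source and
target (the tree's `isOfHodgeType_complexGysin_of_cupPreservesHodgeType`, with the multiplicativity of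
types supplied by de Rham's theorem `exists_deRhamIsoFamily` through
`cupPreservesHodgeType_of_exists_deRhamIsoFamily`). [cite: VoisinHodgeI2002, §7.3.2 (with Lemma 7.30)] -/
theorem isOfHodgeType_complexGysin_of_models (hI : hodgePQ_independent_of_hodgeModel)
    (hdR : ∀ (E : Type) [NormedAddCommGroup E] [NormedSpace ℂ E] [FiniteDimensional ℂ E],
      Literature.NumberTheory.Transcendental.exists_deRhamIsoFamily 𝓘(ℝ, E))
    (μ : OrientationFamily) {Y' X' : SchemeOver ℂ} (hY : IsSmoothProjective m Y') (hX : IsSmoothProjective n X')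
    (B : HodgeModel m Y') (A : HodgeModel n X') (f : Y' ⟶ X') {a b : ℕ} (hab : a + 2 * n = b + 2 * m)
    {p q p' q' : ℕ} (hp : p' + m = p + n) (hq : q' + m = q + n) {y : complexBetti Y' a}
    (hy : IsOfHodgeType m Y' a p q y) :
    IsOfHodgeType n X' b p' q' (complexGysin μ hY hX f hab y) :=
  isOfHodgeType_complexGysin_of_cupPreservesHodgeType hI μ hY hX B A
    (cupPreservesHodgeType_of_exists_deRhamIsoFamily hI hY B (hdR B.model))
    (cupPreservesHodgeType_of_exists_deRhamIsoFamily hI hX A (hdR A.model)) f hab hp hq hy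

end Corr

/-! ### Gysin morphisms on rational classes, up to one scalar -/

section Rational

variable {m n : ℕ} {Y X : SchemeOver ℂ}

/-- **`complexGysin μ` maps rational classes to rational classes up to ONE non-zero scalar**: for
`f : Y ⟶ X` of smooth projective varieties and degrees `a + 2 dim X = b + 2 dim Y` there is `u ≠ 0`
with `u • f_* y` rational for every rational `y ∈ Hᵃ(Y(ℂ))` — `f_*` is, on the image of
`Hᵃ(Y(ℂ); ℚ)`, the rational Gysin morphism times the orientation scalar
(`complexGysin_ringChange_eq_smul_gysinMap`, with `ℚ`-orientations of `Y(ℂ)`, `X(ℂ)`, which exist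
and satisfy Poincaré duality). [cite: VoisinHodgeI2002, §7.3.2] [cite: FultonYoungTableaux1997, Appendix B §B.1 (5)] -/
theorem exists_smul_complexGysin_isRationalClass (μ : OrientationFamily)
    (hY : IsSmoothProjective m Y) (hX : IsSmoothProjective n X) (f : Y ⟶ X) {a b : ℕ}
    (hab : a + 2 * n = b + 2 * m) :
    ∃ u : ℂ, u ≠ 0 ∧ ∀ y : complexBetti Y a, IsRationalClass y →
      IsRationalClass (u • complexGysin μ hY hX f hab y) := by
  by_cases ha : a ≤ 2 * m
  swap
  · refine ⟨1, one_ne_zero, fun y _ ↦ ?_⟩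
    rw [complexGysin_of_lt hY hX f hab (not_le.1 ha), LinearMap.zero_apply, smul_zero]
    exact IsRationalClass.zero
  obtain ⟨q, hq⟩ : ∃ q, a + q = 2 * m := ⟨2 * m - a, by omega⟩
  have hbq : b + q = 2 * n := by omega
  obtain ⟨νY⟩ := ComplexPoints.isOrientableOver ℚ hY
  obtain ⟨νX⟩ := ComplexPoints.isOrientableOver ℚ hX
  have hνX : νX.HasPoincareDuality := fun _ _ h ↦
    ComplexPoints.bijective_poincareDualityMap_of (fun ν _ _ h' ↦ poincare_duality ν h') hX νX h
  obtain ⟨u₀, hu₀, hG⟩ := complexGysin_ringChange_eq_smul_gysinMap μ.hasPoincareDuality hY hX f hq hbq νY νX hνX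
  refine ⟨u₀⁻¹, inv_ne_zero hu₀, fun y hy ↦ ?_⟩
  obtain ⟨z, rfl⟩ := hy.exists_ringChange_eq
  rw [hG z, smul_smul, inv_mul_cancel₀ hu₀, one_smul]
  exact isRationalClass_ringChange _

end Rational

/-! ### Endomorphisms of `H²` of a K3 surface: type preservation from the three pieces -/

section K3

variable {S : SchemeOver ℂ}

/-- **An endomorphism of `H²(S(ℂ); ℂ)` of a projective K3 surface which fixes the line `H^{2,0} = ℂσ`,
the line `H^{0,2} = ℂσ̄` and the subspace `H^{1,1}` preserves EVERY Hodge type `(i, j)`**: by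
`Huybrechts_K3_hodgeTypes_H2` these are the three types in degree `2`, and a class of any other
type `(i, j)` in degree `2` is zero (the sibling lemma `isOfHodgeType_eq_zero_of_add_ne`).
[cite: Huybrechts2016K3, Ch. 6 Prop. 1.2 and Ch. 1 §2.4 (2.7)] -/
theorem typePreserving_of_lines (hHT : Huybrechts_K3_hodgeTypes_H2) (hS : IsK3Surface S)
    {σ : complexBetti S (2 * 1)} (hσ : IsOfHodgeType 2 S (2 * 1) 2 0 σ) (hσ0 : σ ≠ 0)
    (G : complexBetti S (2 * 1) →ₗ[ℂ] complexBetti S (2 * 1))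
    (h20 : ∃ t : ℂ, G σ = t • σ)
    (h02 : ∃ t : ℂ, G (conjClass (ComplexPoints S) (2 * 1) σ) = t • conjClass (ComplexPoints S) (2 * 1) σ)
    (h11 : ∀ v, IsOfHodgeType 2 S (2 * 1) 1 1 v → IsOfHodgeType 2 S (2 * 1) 1 1 (G v))
    (i j : ℕ) (v : complexBetti S (2 * 1)) (hv : IsOfHodgeType 2 S (2 * 1) i j v) :
    IsOfHodgeType 2 S (2 * 1) i j (G v) := by
  obtain ⟨A⟩ := hS.nonempty_hodgeModel
  by_cases hij : i + j = 2 * 1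
  swap
  · rw [isOfHodgeType_eq_zero_of_add_ne hv hij, map_zero]
    exact IsOfHodgeType.zero A _ _ _
  have hcases : (i = 2 ∧ j = 0) ∨ (i = 1 ∧ j = 1) ∨ (i = 0 ∧ j = 2) := by omega
  obtain ⟨h₁, h₂, h₃⟩ := hHT S hS σ hσ hσ0
  rcases hcases with ⟨rfl, rfl⟩ | ⟨rfl, rfl⟩ | ⟨rfl, rfl⟩
  · obtain ⟨t, rfl⟩ := (h₁ v).1 hv
    obtain ⟨t', ht'⟩ := h20
    exact (h₁ _).2 ⟨t * t', by rw [map_smul, ht', smul_smul]⟩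
  · exact h11 v hv
  · obtain ⟨t, rfl⟩ := (h₂ v).1 hv
    obtain ⟨t', ht'⟩ := h02
    exact (h₂ _).2 ⟨t * t', by rw [map_smul, ht', smul_smul]⟩

end K3

end Summit.HodgeConjecture.HodgeConjecture.Theorems.NikulinTwinTransport

end
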